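import Summits.AtomisticToContinuum.Crystallization.Theorems.ExcessDecayLiouvilleCaccioppoliLocal
import Summits.AtomisticToContinuum.Crystallization.Theorems.ExcessDecayLiouvilleGradientEstimate
import Summits.AtomisticToContinuum.Crystallization.Theorems.ExcessDecayLiouvilleVerticalDifferences

/-!
# Route `ExcessDecayLiouville`: the LOCALISED interior gradient estimate

Step (c2) of the energy route for item `ExcessDecay` (stmt-AtomisticToContinuum-9334; item evidence
`ExcessDecay-proof-architecture-v2/v3.md`), in the form that can be ITERATED on difference quotients: the `ℓ²` mass on
the right-hand side is localised to a neighbourhood of the ball carrying the cutoff (via `abs_cutoffForm_le_local`).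
For a finitely supported `h` with `‖h‖ ≤ B`, a cutoff `η` with values in `[0,1]`, finitely supported inside the site set,
vanishing at the sites outside `B_R(c)` and of slope `1/ρ` between sites (`ρ ≥ 1`), the coercivity constant `κ ≥ 0`:

* `caccioppoli_l2_local` :
  `κ·nnForm(η•h) ≤ Σ'_p η_p² ⟪(Lh)(p), h p⟫ + (19·C₆/ρ²) Σ'_p ‖h p‖²·𝟙[dist p c ≤ R+ρ] + 38·F₈(ρ)·B²·(2R/(23/25)+1)³`,
  `C₆ = 1024/(23/25)⁶`, `F₈(ρ) = 1024/((23/25)³ρ⁵)`;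
* `gradient_estimate_local_of_cutoff` : for `τ ∈ Λ₀`, `‖Aτ‖ ≤ 11/10` and a finite set `F` of sites at which (and at
  whose `Aτ`-translates) `η = 1`, `κ·Σ_{x∈F} ‖h x − h (x + Aτ)‖²` is bounded by the same right-hand side;
* `gradient_estimate_local` : the same with the radial site cutoff of `ExcessDecayLiouvilleCutoff.lean` at radii
  `r₁ < r₁ + ρ` (`R = r₁ + ρ`), for every finite set `F` of sites with `dist x c ≤ r₁ − 11/10`;
* `vertical_gradient_estimate_local_of_cutoff` : the analogue for the vertical period `w₃ = 2√(2/3)e₃` (not a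
  nearest-neighbour translation), with an extra factor `4` from `tsum_norm_sub_vertical_sq_le_nnForm`.

All `[folklore]`; helper lemmas, nothing here closes an item.
-/

noncomputable section

namespace Summit.AtomisticToContinuum.Crystallization.Theorems.ExcessDecayLiouville

open scoped BigOperators Topology InnerProductSpace RealInnerProductSpace Classical
open Literature.MathematicalPhysics.StatisticalMechanics
open Summit.AtomisticToContinuum.Crystallization.Theorems.PhononStabilityNegative

section

variable {t : Fin 2 → (EuclideanSpace ℝ (Fin 3))} {A : (EuclideanSpace ℝ (Fin 3)) →L[ℝ] (EuclideanSpace ℝ (Fin 3))}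

/-- **Localised inhomogeneous Caccioppoli inequality** (see the module docstring). [folklore] -/
theorem caccioppoli_l2_local (hA : Adm₀ A) (hI : Inner₀ t A) {κ : ℝ}
    (hκ : ∀ v : (EuclideanSpace ℝ (Fin 3)) → (EuclideanSpace ℝ (Fin 3)), (Function.support v).Finite → Function.support v ⊆ Sites₀ t A →
      κ * nnForm t A v ≤ ∑' p : Sites₀ t A, ⟪∑' q : Sites₀ t A,
        (if (p : (EuclideanSpace ℝ (Fin 3))) ≠ q then ((-((‖(p : (EuclideanSpace ℝ (Fin 3))) - q‖ ^ 2)⁻¹) ^ 7 + ((‖(p : (EuclideanSpace ℝ (Fin 3))) - q‖ ^ 2)⁻¹) ^ 4) • (v p - v q) + (2 * ⟪(p : (EuclideanSpace ℝ (Fin 3))) - q, v p - v q⟫ * (7 * ((‖(p : (EuclideanSpace ℝ (Fin 3))) - q‖ ^ 2)⁻¹) ^ 8 - 4 * ((‖(p : (EuclideanSpace ℝ (Fin 3))) - q‖ ^ 2)⁻¹) ^ 5)) • ((p : (EuclideanSpace ℝ (Fin 3))) - q)) else 0), v p⟫)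
    {h : (EuclideanSpace ℝ (Fin 3)) → (EuclideanSpace ℝ (Fin 3))} (hh : (Function.support h).Finite) {B : ℝ} (hB : ∀ x, ‖h x‖ ≤ B)
    {η : (EuclideanSpace ℝ (Fin 3)) → ℝ} (hη : (Function.support η).Finite) (hηS : Function.support η ⊆ Sites₀ t A)
    (hη0 : ∀ x, 0 ≤ η x) (hη1 : ∀ x, η x ≤ 1)
    {c : (EuclideanSpace ℝ (Fin 3))} {R ρ : ℝ} (hρ : 1 ≤ ρ) (hR : 0 ≤ R)
    (hηR : ∀ p : Sites₀ t A, R < dist (p : (EuclideanSpace ℝ (Fin 3))) c → η p = 0)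
    (hlip : ∀ p q : Sites₀ t A, |η p - η q| ≤ ‖(p : (EuclideanSpace ℝ (Fin 3))) - q‖ / ρ) :
    κ * nnForm t A (fun x => η x • h x) ≤
      (∑' p : Sites₀ t A, (η p) ^ 2 * ⟪∑' q : Sites₀ t A, (if (p : (EuclideanSpace ℝ (Fin 3))) ≠ q then ((-((‖(p : (EuclideanSpace ℝ (Fin 3))) - q‖ ^ 2)⁻¹) ^ 7 + ((‖(p : (EuclideanSpace ℝ (Fin 3))) - q‖ ^ 2)⁻¹) ^ 4) • (h p - h q) + (2 * ⟪(p : (EuclideanSpace ℝ (Fin 3))) - q, h p - h q⟫ * (7 * ((‖(p : (EuclideanSpace ℝ (Fin 3))) - q‖ ^ 2)⁻¹) ^ 8 - 4 * ((‖(p : (EuclideanSpace ℝ (Fin 3))) - q‖ ^ 2)⁻¹) ^ 5)) • ((p : (EuclideanSpace ℝ (Fin 3))) - q)) else 0), h p⟫) +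
      (19 * (1024 / ((23 / 25 : ℝ) ^ 3 * (23 / 25 : ℝ) ^ 3)) / ρ ^ 2 * (∑' p : Sites₀ t A, ‖h p‖ ^ 2 * (if dist (p : (EuclideanSpace ℝ (Fin 3))) c ≤ R + ρ then (1 : ℝ) else 0)) + 38 * (1024 / ((23 / 25 : ℝ) ^ 3 * ρ ^ 5)) * B ^ 2 * (2 * R / (23 / 25) + 1) ^ 3) := by
  have h1 := caccioppoli_inhomogeneous hA hI hκ hB hη hηS
  have h2 := abs_cutoffForm_le_local hA hI hh hB hη0 hη1 hρ hR hηR hlip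
  linarith [h1, (le_abs_self _).trans h2]

/-- **Localised interior gradient estimate for an abstract cutoff** (see the module docstring). [folklore] -/
theorem gradient_estimate_local_of_cutoff (hA : Adm₀ A) (hI : Inner₀ t A) {κ : ℝ} (hκ0 : 0 ≤ κ)
    (hκ : ∀ v : (EuclideanSpace ℝ (Fin 3)) → (EuclideanSpace ℝ (Fin 3)), (Function.support v).Finite → Function.support v ⊆ Sites₀ t A →
      κ * nnForm t A v ≤ ∑' p : Sites₀ t A, ⟪∑' q : Sites₀ t A,
        (if (p : (EuclideanSpace ℝ (Fin 3))) ≠ q then ((-((‖(p : (EuclideanSpace ℝ (Fin 3))) - q‖ ^ 2)⁻¹) ^ 7 + ((‖(p : (EuclideanSpace ℝ (Fin 3))) - q‖ ^ 2)⁻¹) ^ 4) • (v p - v q) + (2 * ⟪(p : (EuclideanSpace ℝ (Fin 3))) - q, v p - v q⟫ * (7 * ((‖(p : (EuclideanSpace ℝ (Fin 3))) - q‖ ^ 2)⁻¹) ^ 8 - 4 * ((‖(p : (EuclideanSpace ℝ (Fin 3))) - q‖ ^ 2)⁻¹) ^ 5)) • ((p : (EuclideanSpace ℝ (Fin 3)))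 - q)) else 0), v p⟫)
    {h : (EuclideanSpace ℝ (Fin 3)) → (EuclideanSpace ℝ (Fin 3))} (hh : (Function.support h).Finite) {B : ℝ} (hB : ∀ x, ‖h x‖ ≤ B)
    {η : (EuclideanSpace ℝ (Fin 3)) → ℝ} (hη : (Function.support η).Finite) (hηS : Function.support η ⊆ Sites₀ t A)
    (hη0 : ∀ x, 0 ≤ η x) (hη1 : ∀ x, η x ≤ 1)
    {c : (EuclideanSpace ℝ (Fin 3))} {R ρ : ℝ} (hρ : 1 ≤ ρ) (hR : 0 ≤ R)
    (hηR : ∀ p : Sites₀ t A, R < dist (p : (EuclideanSpace ℝ (Fin 3))) c → η p = 0)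
    (hlip : ∀ p q : Sites₀ t A, |η p - η q| ≤ ‖(p : (EuclideanSpace ℝ (Fin 3))) - q‖ / ρ)
    {τ : (EuclideanSpace ℝ (Fin 3))} (hτ : τ ∈ Λ₀) (hτn : ‖A τ‖ ≤ 11 / 10)
    (F : Finset (EuclideanSpace ℝ (Fin 3))) (hF : ∀ x ∈ F, x ∈ Sites₀ t A ∧ η x = 1 ∧ η (x + A τ) = 1) :
    κ * ∑ x ∈ F, ‖h x - h (x + A τ)‖ ^ 2 ≤
      (∑' p : Sites₀ t A, (η p) ^ 2 * ⟪∑' q : Sites₀ t A, (if (p : (EuclideanSpace ℝ (Fin 3))) ≠ q then ((-((‖(p : (EuclideanSpace ℝ (Fin 3))) - q‖ ^ 2)⁻¹) ^ 7 + ((‖(p : (EuclideanSpace ℝ (Fin 3))) - q‖ ^ 2)⁻¹) ^ 4) • (h p - h q) + (2 * ⟪(p : (EuclideanSpace ℝ (Fin 3))) - q, h p - h q⟫ * (7 * ((‖(p : (EuclideanSpace ℝ (Fin 3))) - q‖ ^ 2)⁻¹) ^ 8 - 4 * ((‖(p : (EuclideanSpace ℝ (Fin 3))) - q‖ ^ 2)⁻¹)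 ^ 5)) • ((p : (EuclideanSpace ℝ (Fin 3))) - q)) else 0), h p⟫) +
      (19 * (1024 / ((23 / 25 : ℝ) ^ 3 * (23 / 25 : ℝ) ^ 3)) / ρ ^ 2 * (∑' p : Sites₀ t A, ‖h p‖ ^ 2 * (if dist (p : (EuclideanSpace ℝ (Fin 3))) c ≤ R + ρ then (1 : ℝ) else 0)) + 38 * (1024 / ((23 / 25 : ℝ) ^ 3 * ρ ^ 5)) * B ^ 2 * (2 * R / (23 / 25) + 1) ^ 3) := by
  classical
  have hC := caccioppoli_l2_local hA hI hκ hh hB hη hηS hη0 hη1 hρ hR hηR hlip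
  have ha : (Function.support fun x : (EuclideanSpace ℝ (Fin 3)) => η x • h x).Finite :=
    hη.subset fun x hx => by
      simp only [Function.mem_support, ne_eq, smul_eq_zero, not_or] at hx ⊢
      exact hx.1
  have hD := tsum_norm_sub_translate_sq_le_nnForm hA hI ha hτ hτn
  have hsum : Summable (fun p : Sites₀ t A =>
      ‖η p • h p - η ((p : (EuclideanSpace ℝ (Fin 3))) + A τ) • h ((p : (EuclideanSpace ℝ (Fin 3))) + A τ)‖ ^ 2) :=
    summable_norm_sub_translate_sq (t := t) (A := A) ha hτ
  set G : Finset (Sites₀ t A) := F.attach.image (fun x => ⟨x.1, (hF x.1 x.2).1⟩) with hG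
  have hinj : Set.InjOn (fun x : {x // x ∈ F} => (⟨x.1, (hF x.1 x.2).1⟩ : Sites₀ t A))
      (F.attach : Set {x // x ∈ F}) := by
    intro a _ b _ hab
    have : (a : (EuclideanSpace ℝ (Fin 3))) = b := congrArg (fun s : Sites₀ t A => (s : (EuclideanSpace ℝ (Fin 3)))) hab
    exact Subtype.ext this
  have hpart : ∑ x ∈ F, ‖h x - h (x + A τ)‖ ^ 2 ≤
      ∑' p : Sites₀ t A, ‖η p • h p - η ((p : (EuclideanSpace ℝ (Fin 3))) + A τ) • h ((p : (EuclideanSpace ℝ (Fin 3))) + A τ)‖ ^ 2 := by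
    have h1 : ∑ x ∈ F, ‖h x - h (x + A τ)‖ ^ 2 =
        ∑ p ∈ G, ‖η p • h p - η ((p : (EuclideanSpace ℝ (Fin 3))) + A τ) • h ((p : (EuclideanSpace ℝ (Fin 3))) + A τ)‖ ^ 2 := by
      rw [hG, Finset.sum_image hinj, ← Finset.sum_attach F]
      refine Finset.sum_congr rfl fun x _ => ?_
      obtain ⟨-, hx1, hx2⟩ := hF x.1 x.2
      simp only [hx1, hx2, one_smul]
    rw [h1]
    exact hsum.sum_le_tsum G (fun p _ => sq_nonneg _)
  calc κ * ∑ x ∈ F, ‖h x - h (x + A τ)‖ ^ 2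
      ≤ κ * ∑' p : Sites₀ t A, ‖η p • h p - η ((p : (EuclideanSpace ℝ (Fin 3))) + A τ) • h ((p : (EuclideanSpace ℝ (Fin 3))) + A τ)‖ ^ 2 :=
        mul_le_mul_of_nonneg_left hpart hκ0
    _ ≤ κ * nnForm t A (fun x => η x • h x) := mul_le_mul_of_nonneg_left hD hκ0
    _ ≤ _ := hC

/-- **Localised interior gradient estimate** with the radial site cutoff at radii `r₁ < r₁ + ρ` (`0 ≤ r₁`, `ρ ≥ 1`):
for every finite set `F` of sites with `dist x c ≤ r₁ − 11/10`, with `R = r₁ + ρ`,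
`κ·Σ_{x∈F} ‖h x − h (x + Aτ)‖² ≤ Σ' η² ⟪Lh, h⟫ + (19·C₆/ρ²) Σ' ‖h p‖²·𝟙[dist p c ≤ R + ρ] + 38·F₈(ρ)·B²·(2R/(23/25)+1)³`.
[folklore] -/
theorem gradient_estimate_local (hA : Adm₀ A) (hI : Inner₀ t A) {κ : ℝ} (hκ0 : 0 ≤ κ)
    (hκ : ∀ v : (EuclideanSpace ℝ (Fin 3)) → (EuclideanSpace ℝ (Fin 3)), (Function.support v).Finite → Function.support v ⊆ Sites₀ t A →
      κ * nnForm t A v ≤ ∑' p : Sites₀ t A, ⟪∑' q : Sites₀ t A,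
        (if (p : (EuclideanSpace ℝ (Fin 3))) ≠ q then ((-((‖(p : (EuclideanSpace ℝ (Fin 3))) - q‖ ^ 2)⁻¹) ^ 7 + ((‖(p : (EuclideanSpace ℝ (Fin 3))) - q‖ ^ 2)⁻¹) ^ 4) • (v p - v q) + (2 * ⟪(p : (EuclideanSpace ℝ (Fin 3))) - q, v p - v q⟫ * (7 * ((‖(p : (EuclideanSpace ℝ (Fin 3))) - q‖ ^ 2)⁻¹) ^ 8 - 4 * ((‖(p : (EuclideanSpace ℝ (Fin 3))) - q‖ ^ 2)⁻¹) ^ 5)) • ((p : (EuclideanSpace ℝ (Fin 3))) - q)) else 0), v p⟫)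
    {h : (EuclideanSpace ℝ (Fin 3)) → (EuclideanSpace ℝ (Fin 3))} (hh : (Function.support h).Finite) {B : ℝ} (hB : ∀ x, ‖h x‖ ≤ B)
    (c : (EuclideanSpace ℝ (Fin 3))) {r₁ ρ : ℝ} (hr₁ : 0 ≤ r₁) (hρ : 1 ≤ ρ) {τ : (EuclideanSpace ℝ (Fin 3))} (hτ : τ ∈ Λ₀) (hτn : ‖A τ‖ ≤ 11 / 10)
    (F : Finset (EuclideanSpace ℝ (Fin 3))) (hF : ∀ x ∈ F, x ∈ Sites₀ t A ∧ dist x c ≤ r₁ - 11 / 10) :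
    κ * ∑ x ∈ F, ‖h x - h (x + A τ)‖ ^ 2 ≤
      (∑' p : Sites₀ t A,
        ((if (p : (EuclideanSpace ℝ (Fin 3))) ∈ Sites₀ t A then max (min 1 ((r₁ + ρ - dist (p : (EuclideanSpace ℝ (Fin 3))) c) / ρ)) 0 else 0)) ^ 2 *
          ⟪∑' q : Sites₀ t A, (if (p : (EuclideanSpace ℝ (Fin 3))) ≠ q then ((-((‖(p : (EuclideanSpace ℝ (Fin 3))) - q‖ ^ 2)⁻¹) ^ 7 + ((‖(p : (EuclideanSpace ℝ (Fin 3))) - q‖ ^ 2)⁻¹) ^ 4) • (h p - h q) + (2 * ⟪(p : (EuclideanSpace ℝ (Fin 3))) - q, h p - h q⟫ * (7 * ((‖(p : (EuclideanSpace ℝ (Fin 3))) - q‖ ^ 2)⁻¹) ^ 8 - 4 * ((‖(p : (EuclideanSpace ℝ (Fin 3))) - q‖ ^ 2)⁻¹) ^ 5)) • ((p : (EuclideanSpace ℝ (Fin 3))) - q)) else 0), h p⟫) +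
      (19 * (1024 / ((23 / 25 : ℝ) ^ 3 * (23 / 25 : ℝ) ^ 3)) / ρ ^ 2 * (∑' p : Sites₀ t A, ‖h p‖ ^ 2 * (if dist (p : (EuclideanSpace ℝ (Fin 3))) c ≤ (r₁ + ρ) + ρ then (1 : ℝ) else 0)) +
        38 * (1024 / ((23 / 25 : ℝ) ^ 3 * ρ ^ 5)) * B ^ 2 * (2 * (r₁ + ρ) / (23 / 25) + 1) ^ 3) := by
  have hρ0 : 0 < ρ := by linarith
  refine gradient_estimate_local_of_cutoff hA hI hκ0 hκ hh hB
    (η := fun x : (EuclideanSpace ℝ (Fin 3)) => (if x ∈ Sites₀ t A then max (min 1 ((r₁ + ρ - dist x c) / ρ)) 0 else 0))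
    (siteCutoff_support_finite hA hI c r₁ hρ0) (siteCutoff_support_subset c r₁ ρ)
    (fun x => siteCutoff_nonneg c r₁ ρ x) (fun x => siteCutoff_le_one c r₁ ρ x) hρ (by linarith)
    (fun p hp => siteCutoff_eq_zero_of_le hρ0 hp.le)
    (fun p q => abs_siteCutoff_sub_le hρ0 p q) hτ hτn F fun x hx => ?_
  obtain ⟨hxS, hxc⟩ := hF x hx
  have hx2S : x + A τ ∈ Sites₀ t A := add_mem_sites₀ hxS hτ
  have hx2c : dist (x + A τ) c ≤ r₁ := by
    have := dist_triangle (x + A τ) x c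
    have h2 : dist (x + A τ) x = ‖A τ‖ := by rw [dist_eq_norm, add_sub_cancel_left]
    linarith
  exact ⟨hxS, siteCutoff_eq_one hρ0 hxS (by linarith), siteCutoff_eq_one hρ0 hx2S hx2c⟩

/-- **Localised gradient estimate along an arbitrary lattice period, for an abstract cutoff**: as
`gradient_estimate_local_of_cutoff`, for any `τ ∈ Λ₀` along which the squared differences of finitely supported
displacements are dominated by `M · nnForm` (hypothesis `hdom`; `M = 1` for nearest-neighbour translations by
`tsum_norm_sub_translate_sq_le_nnForm`, `M = 4` for the vertical period by `tsum_norm_sub_vertical_sq_le_nnForm`).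
[folklore] -/
theorem gradient_estimate_local_of_cutoff_of_dom (hA : Adm₀ A) (hI : Inner₀ t A) {κ : ℝ} (hκ0 : 0 ≤ κ)
    (hκ : ∀ v : (EuclideanSpace ℝ (Fin 3)) → (EuclideanSpace ℝ (Fin 3)), (Function.support v).Finite → Function.support v ⊆ Sites₀ t A →
      κ * nnForm t A v ≤ ∑' p : Sites₀ t A, ⟪∑' q : Sites₀ t A,
        (if (p : (EuclideanSpace ℝ (Fin 3))) ≠ q then ((-((‖(p : (EuclideanSpace ℝ (Fin 3))) - q‖ ^ 2)⁻¹) ^ 7 + ((‖(p : (EuclideanSpace ℝ (Fin 3))) - q‖ ^ 2)⁻¹) ^ 4) • (v p - v q) + (2 * ⟪(p : (EuclideanSpace ℝ (Fin 3))) - q, v p - v q⟫ * (7 * ((‖(p : (EuclideanSpace ℝ (Fin 3))) - q‖ ^ 2)⁻¹) ^ 8 - 4 * ((‖(p : (EuclideanSpace ℝ (Fin 3))) - q‖ ^ 2)⁻¹) ^ 5)) • ((p : (EuclideanSpace ℝ (Fin 3))) - q)) else 0), v p⟫)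
    {h : (EuclideanSpace ℝ (Fin 3)) → (EuclideanSpace ℝ (Fin 3))} (hh : (Function.support h).Finite) {B : ℝ} (hB : ∀ x, ‖h x‖ ≤ B)
    {η : (EuclideanSpace ℝ (Fin 3)) → ℝ} (hη : (Function.support η).Finite) (hηS : Function.support η ⊆ Sites₀ t A)
    (hη0 : ∀ x, 0 ≤ η x) (hη1 : ∀ x, η x ≤ 1)
    {c : (EuclideanSpace ℝ (Fin 3))} {R ρ : ℝ} (hρ : 1 ≤ ρ) (hR : 0 ≤ R)
    (hηR : ∀ p : Sites₀ t A, R < dist (p : (EuclideanSpace ℝ (Fin 3))) c → η p = 0)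
    (hlip : ∀ p q : Sites₀ t A, |η p - η q| ≤ ‖(p : (EuclideanSpace ℝ (Fin 3))) - q‖ / ρ)
    {τ : (EuclideanSpace ℝ (Fin 3))} (hτ : τ ∈ Λ₀) {M : ℝ} (hM : 0 ≤ M)
    (hdom : ∀ v : (EuclideanSpace ℝ (Fin 3)) → (EuclideanSpace ℝ (Fin 3)), (Function.support v).Finite →
      ∑' p : Sites₀ t A, ‖v p - v ((p : (EuclideanSpace ℝ (Fin 3))) + A τ)‖ ^ 2 ≤ M * nnForm t A v)
    (F : Finset (EuclideanSpace ℝ (Fin 3))) (hF : ∀ x ∈ F, x ∈ Sites₀ t A ∧ η x = 1 ∧ η (x + A τ) = 1) :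
    κ * ∑ x ∈ F, ‖h x - h (x + A τ)‖ ^ 2 ≤
      M * ((∑' p : Sites₀ t A, (η p) ^ 2 * ⟪∑' q : Sites₀ t A, (if (p : (EuclideanSpace ℝ (Fin 3))) ≠ q then ((-((‖(p : (EuclideanSpace ℝ (Fin 3))) - q‖ ^ 2)⁻¹) ^ 7 + ((‖(p : (EuclideanSpace ℝ (Fin 3))) - q‖ ^ 2)⁻¹) ^ 4) • (h p - h q) + (2 * ⟪(p : (EuclideanSpace ℝ (Fin 3))) - q, h p - h q⟫ * (7 * ((‖(p : (EuclideanSpace ℝ (Fin 3))) - q‖ ^ 2)⁻¹) ^ 8 - 4 * ((‖(p : (EuclideanSpace ℝ (Fin 3))) - q‖ ^ 2)⁻¹) ^ 5)) • ((p : (EuclideanSpace ℝ (Fin 3))) - q)) else 0), h p⟫) +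
      (19 * (1024 / ((23 / 25 : ℝ) ^ 3 * (23 / 25 : ℝ) ^ 3)) / ρ ^ 2 * (∑' p : Sites₀ t A, ‖h p‖ ^ 2 * (if dist (p : (EuclideanSpace ℝ (Fin 3))) c ≤ R + ρ then (1 : ℝ) else 0)) + 38 * (1024 / ((23 / 25 : ℝ) ^ 3 * ρ ^ 5)) * B ^ 2 * (2 * R / (23 / 25) + 1) ^ 3)) := by
  classical
  have hC := caccioppoli_l2_local hA hI hκ hh hB hη hηS hη0 hη1 hρ hR hηR hlip
  have ha : (Function.support fun x : (EuclideanSpace ℝ (Fin 3)) => η x • h x).Finite :=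
    hη.subset fun x hx => by
      simp only [Function.mem_support, ne_eq, smul_eq_zero, not_or] at hx ⊢
      exact hx.1
  have hD := hdom _ ha
  have hsum : Summable (fun p : Sites₀ t A =>
      ‖η p • h p - η ((p : (EuclideanSpace ℝ (Fin 3))) + A τ) • h ((p : (EuclideanSpace ℝ (Fin 3))) + A τ)‖ ^ 2) :=
    summable_norm_sub_translate_sq (t := t) (A := A) ha hτ
  set G : Finset (Sites₀ t A) := F.attach.image (fun x => ⟨x.1, (hF x.1 x.2).1⟩) with hG
  have hinj : Set.InjOn (fun x : {x // x ∈ F} => (⟨x.1, (hF x.1 x.2).1⟩ : Sites₀ t A))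
      (F.attach : Set {x // x ∈ F}) := by
    intro a _ b _ hab
    have : (a : (EuclideanSpace ℝ (Fin 3))) = b := congrArg (fun s : Sites₀ t A => (s : (EuclideanSpace ℝ (Fin 3)))) hab
    exact Subtype.ext this
  have hpart : ∑ x ∈ F, ‖h x - h (x + A τ)‖ ^ 2 ≤
      ∑' p : Sites₀ t A, ‖η p • h p - η ((p : (EuclideanSpace ℝ (Fin 3))) + A τ) • h ((p : (EuclideanSpace ℝ (Fin 3))) + A τ)‖ ^ 2 := by
    have h1 : ∑ x ∈ F, ‖h x - h (x + A τ)‖ ^ 2 =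
        ∑ p ∈ G, ‖η p • h p - η ((p : (EuclideanSpace ℝ (Fin 3))) + A τ) • h ((p : (EuclideanSpace ℝ (Fin 3))) + A τ)‖ ^ 2 := by
      rw [hG, Finset.sum_image hinj, ← Finset.sum_attach F]
      refine Finset.sum_congr rfl fun x _ => ?_
      obtain ⟨-, hx1, hx2⟩ := hF x.1 x.2
      simp only [hx1, hx2, one_smul]
    rw [h1]
    exact hsum.sum_le_tsum G (fun p _ => sq_nonneg _)
  calc κ * ∑ x ∈ F, ‖h x - h (x + A τ)‖ ^ 2
      ≤ κ * ∑' p : Sites₀ t A, ‖η p • h p - η ((p : (EuclideanSpace ℝ (Fin 3))) + A τ) • h ((p : (EuclideanSpace ℝ (Fin 3))) + A τ)‖ ^ 2 :=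
        mul_le_mul_of_nonneg_left hpart hκ0
    _ ≤ κ * (M * nnForm t A (fun x => η x • h x)) := mul_le_mul_of_nonneg_left hD hκ0
    _ = M * (κ * nnForm t A (fun x => η x • h x)) := by ring
    _ ≤ _ := mul_le_mul_of_nonneg_left hC hM

/-- **Localised vertical gradient estimate** (vertical period `w₃ = 2√(2/3)e₃`, factor `4`). [folklore] -/
theorem vertical_gradient_estimate_local_of_cutoff (hA : Adm₀ A) (hI : Inner₀ t A) {κ : ℝ} (hκ0 : 0 ≤ κ)
    (hκ : ∀ v : (EuclideanSpace ℝ (Fin 3)) → (EuclideanSpace ℝ (Fin 3)), (Function.support v).Finite → Function.support v ⊆ Sites₀ t A →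
      κ * nnForm t A v ≤ ∑' p : Sites₀ t A, ⟪∑' q : Sites₀ t A,
        (if (p : (EuclideanSpace ℝ (Fin 3))) ≠ q then ((-((‖(p : (EuclideanSpace ℝ (Fin 3))) - q‖ ^ 2)⁻¹) ^ 7 + ((‖(p : (EuclideanSpace ℝ (Fin 3))) - q‖ ^ 2)⁻¹) ^ 4) • (v p - v q) + (2 * ⟪(p : (EuclideanSpace ℝ (Fin 3))) - q, v p - v q⟫ * (7 * ((‖(p : (EuclideanSpace ℝ (Fin 3))) - q‖ ^ 2)⁻¹) ^ 8 - 4 * ((‖(p : (EuclideanSpace ℝ (Fin 3))) - q‖ ^ 2)⁻¹) ^ 5)) • ((p : (EuclideanSpace ℝ (Fin 3))) - q)) else 0), v p⟫)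
    {h : (EuclideanSpace ℝ (Fin 3)) → (EuclideanSpace ℝ (Fin 3))} (hh : (Function.support h).Finite) {B : ℝ} (hB : ∀ x, ‖h x‖ ≤ B)
    {η : (EuclideanSpace ℝ (Fin 3)) → ℝ} (hη : (Function.support η).Finite) (hηS : Function.support η ⊆ Sites₀ t A)
    (hη0 : ∀ x, 0 ≤ η x) (hη1 : ∀ x, η x ≤ 1)
    {c : (EuclideanSpace ℝ (Fin 3))} {R ρ : ℝ} (hρ : 1 ≤ ρ) (hR : 0 ≤ R)
    (hηR : ∀ p : Sites₀ t A, R < dist (p : (EuclideanSpace ℝ (Fin 3))) c → η p = 0)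
    (hlip : ∀ p q : Sites₀ t A, |η p - η q| ≤ ‖(p : (EuclideanSpace ℝ (Fin 3))) - q‖ / ρ)
    (F : Finset (EuclideanSpace ℝ (Fin 3))) (hF : ∀ x ∈ F, x ∈ Sites₀ t A ∧ η x = 1 ∧ η (x + A (layerNormal (2 * Real.sqrt (2 / 3)))) = 1) :
    κ * ∑ x ∈ F, ‖h x - h (x + A (layerNormal (2 * Real.sqrt (2 / 3))))‖ ^ 2 ≤
      4 * ((∑' p : Sites₀ t A, (η p) ^ 2 * ⟪∑' q : Sites₀ t A, (if (p : (EuclideanSpace ℝ (Fin 3))) ≠ q then ((-((‖(p : (EuclideanSpace ℝ (Fin 3))) - q‖ ^ 2)⁻¹) ^ 7 + ((‖(p : (EuclideanSpace ℝ (Fin 3))) - q‖ ^ 2)⁻¹) ^ 4) • (h p - h q) + (2 * ⟪(p : (EuclideanSpace ℝ (Fin 3))) - q, h p - h q⟫ * (7 * ((‖(p : (EuclideanSpace ℝ (Fin 3))) - q‖ ^ 2)⁻¹) ^ 8 - 4 * ((‖(p : (EuclideanSpace ℝ (Fin 3))) - q‖ ^ 2)⁻¹) ^ 5)) • ((p :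 (EuclideanSpace ℝ (Fin 3))) - q)) else 0), h p⟫) +
      (19 * (1024 / ((23 / 25 : ℝ) ^ 3 * (23 / 25 : ℝ) ^ 3)) / ρ ^ 2 * (∑' p : Sites₀ t A, ‖h p‖ ^ 2 * (if dist (p : (EuclideanSpace ℝ (Fin 3))) c ≤ R + ρ then (1 : ℝ) else 0)) + 38 * (1024 / ((23 / 25 : ℝ) ^ 3 * ρ ^ 5)) * B ^ 2 * (2 * R / (23 / 25) + 1) ^ 3)) :=
  gradient_estimate_local_of_cutoff_of_dom hA hI hκ0 hκ hh hB hη hηS hη0 hη1 hρ hR hηR hlip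
    layerNormal_two_mem_Λ₀ (by norm_num) (fun _ hv => tsum_norm_sub_vertical_sq_le_nnForm hA hI hv) F hF

end

end Summit.AtomisticToContinuum.Crystallization.Theorems.ExcessDecayLiouville

end
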